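import Summits.SmoothPoincare4.SmoothPoincare4.Theorems.CylinderEntropyThinCrossSectionExistsStubZonalSphereIntegral
import Summits.SmoothPoincare4.SmoothPoincare4.Theorems.CylinderEntropyThinCrossSectionExistsStubFunkHeckeVanishing
import Summits.SmoothPoincare4.SmoothPoincare4.Theorems.CylinderEntropyThinCrossSectionExistsStubSliceDensity
import Summits.SmoothPoincare4.SmoothPoincare4.Theorems.CylinderEntropySliceCalibrationGegenbauer
import Literature.Geometry.Riemannian.SphericalCylinderEntropy
import HarnessLib

/-!
# Route `CylinderEntropy`, crux `CylinderRungTwo` (stmt-SmoothPoincare4-7631), line `killing-flux`: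
# mass and first moment of the zonal heat kernel of `S⁴` (registered helper
# `helper_zonalMassAndFirstMoment`, plan step S3m)

For `t > 0` and a unit vector `x ∈ ℝ⁵`, with `S⁴ = Metric.sphere 0 1 ⊂ ℝ⁵`, `s(y) = ∑ᵢ xᵢ yᵢ` and
`𝔥 = Literature.Geometry.Riemannian.SphericalCylinderEntropy.zonal` the typed zonal heat series
`𝔥(t, s) = ∑_k wt k t · C_k^{(3/2)}(s)`, in Mathlib's `μH[4]` normalisation:

* (MASS) `∫_{S⁴} 𝔥(t, s(y)) dμH⁴(y) = μH⁴(S⁴)`;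
* (FIRST MOMENT) `∫_{S⁴} 𝔥(t, s(y)) s(y) dμH⁴(y) = e^{-4t} μH⁴(S⁴)`.

Proof.  Both identities are first proved for the Euclidean-normalised Hausdorff measure `μHE⁴ = c • μH⁴`
(`c ≠ 0`, `SliceDensity.exists_euclideanHausdorff_eq_smul`) and then transported
(`setIntegral_hausdorff_of_euclideanHausdorff`: the constant `c` cancels).  The mass is the landed
`stub_zonalSphereIntegral` fed with the landed Funk–Hecke vanishing `stub_funkHeckeVanishing`
(`∫_{S⁴} C_k(s) dμHE⁴ = 0` for `k ≥ 1`).  For the first moment, `s 𝔥(t, s) = ∑_k wt k t · s C_k(s)`; on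
the sphere `|s| ≤ 1`, so the tree bound `norm_wt_mul_gegen_le` dominates the `k`-th term by the summable
majorant `e^{-k²t}((k+3)!)² 2^k` and `MeasureTheory.integral_tsum_of_summable_integral_norm` exchanges
`∫` and `∑'`.  The three-term recurrence `(j+2) C_{j+2} = (2j+5) s C_{j+1} - (j+3) C_j`
(`CylinderEntropySliceCalibration.eval_gp_rec`, DLMF 18.9.1) gives
`s C_{j+1} = ((j+2) C_{j+2} + (j+3) C_j)/(2j+5)`, and `s C_0 = C_1/3`; integrating and killing every
`∫ C_i`, `i ≥ 1`, only the `k = 1` term survives: `wt 1 t · (3/5) μHE⁴(S⁴) = e^{-4t} (5/3)(3/5) μHE⁴(S⁴)`.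

Everything here is PROVED (no `sorry`, no new definitions, no named facts).

References: NIST DLMF 18.9.1 (three-term recurrence of the ultraspherical polynomials); C. Müller,
*Spherical Harmonics*, LNM 17 (1966), §4 (Funk–Hecke).
-/

-- the prescribed namespace `Summit.SmoothPoincare4.SmoothPoincare4.…` repeats `SmoothPoincare4`
set_option linter.dupNamespace false

noncomputable section

open MeasureTheory Set Filter
open scoped Manifold ContDiff ENNReal NNReal Topology BigOperators

namespace Summit.SmoothPoincare4.SmoothPoincare4.Cruxes.CylinderRungTwo.KillingFlux

open Literature.Geometry.Riemannian.SphericalCylinderEntropy (zonal gegen wt wt_zero gegen_zero)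
open Literature.Geometry.Riemannian.SphericalZonalKernelSeries (norm_wt_mul_gegen_le summable_majorant
  continuous_gegen)
open Summit.SmoothPoincare4.SmoothPoincare4.Theorems.ThinCrossSectionExists.BallMassSlack
  (stub_zonalSphereIntegral stub_funkHeckeVanishing)
open Summit.SmoothPoincare4.SmoothPoincare4.Theorems.ThinCrossSectionExists.BallMassSlack.SliceDensity
  (exists_euclideanHausdorff_eq_smul euclideanHausdorff_sphere_lt_top)
open Summit.SmoothPoincare4.SmoothPoincare4.Theorems.ThinCrossSectionExists.BallMassSlack.ZonalSphereIntegral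
  (abs_sum_mul_le_one_of_mem_sphere)
open Summit.SmoothPoincare4.SmoothPoincare4.Theorems.CylinderEntropySliceCalibration (gegen_eq_eval_gp
  eval_gp_rec gp_one)

namespace ZonalMassAndFirstMoment

/-! ## Transport `μHE⁴ → μH⁴` on the sphere -/

/-- An identity `∫_{S⁴} f dμHE⁴ = r · μHE⁴(S⁴)` transports to `μH⁴`: `μHE⁴ = c • μH⁴` with `c ≠ 0`
and the constant cancels. [folklore] -/
theorem setIntegral_hausdorff_of_euclideanHausdorff {f : EuclideanSpace ℝ (Fin 5) → ℝ} {r : ℝ}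
    (h : ∫ y in Metric.sphere (0 : EuclideanSpace ℝ (Fin 5)) 1, f y
        ∂(μHE[4] : Measure (EuclideanSpace ℝ (Fin 5))) =
      r * ((μHE[4] : Measure (EuclideanSpace ℝ (Fin 5)))
        (Metric.sphere (0 : EuclideanSpace ℝ (Fin 5)) 1)).toReal) :
    ∫ y in Metric.sphere (0 : EuclideanSpace ℝ (Fin 5)) 1, f y
        ∂(μH[4] : Measure (EuclideanSpace ℝ (Fin 5))) =
      r * ((μH[4] : Measure (EuclideanSpace ℝ (Fin 5)))
        (Metric.sphere (0 : EuclideanSpace ℝ (Fin 5)) 1)).toReal := by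
  obtain ⟨c, hc, hdef⟩ := exists_euclideanHausdorff_eq_smul
  rw [hdef, Measure.restrict_smul, integral_smul_nnreal_measure, Measure.smul_apply, NNReal.smul_def,
    smul_eq_mul, ENNReal.smul_def, smul_eq_mul, ENNReal.toReal_mul, ENNReal.coe_toReal,
    mul_left_comm] at h
  exact mul_left_cancel₀ (NNReal.coe_ne_zero.2 hc) h

/-! ## The recurrence, pointwise -/

/-- `C_1^{(3/2)}(s) = 3s`. [folklore] -/
theorem gegen_one_apply (s : ℝ) : gegen 1 s = 3 * s := by
  rw [gegen_eq_eval_gp, gp_one]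
  simp only [Polynomial.eval_mul, Polynomial.eval_ofNat, Polynomial.eval_X]

/-- The three-term recurrence solved for `s C_{j+1}(s)`:
`C_{j+1}(s) s = ((j+2) C_{j+2}(s) + (j+3) C_j(s)) / (2j+5)`. [cite: DLMF, 18.9.1] -/
theorem gegen_succ_mul_self (j : ℕ) (s : ℝ) :
    gegen (j + 1) s * s =
      (((j : ℝ) + 2) * gegen (j + 2) s + ((j : ℝ) + 3) * gegen j s) / (2 * (j : ℝ) + 5) := by
  have h := eval_gp_rec j s
  rw [← gegen_eq_eval_gp, ← gegen_eq_eval_gp, ← gegen_eq_eval_gp] at h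
  have h5 : (2 * (j : ℝ) + 5) ≠ 0 := by positivity
  rw [eq_div_iff h5]
  linear_combination -h

/-! ## Integrals of the Gegenbauer modes over `S⁴` (w.r.t. `μHE⁴`) -/

/-- Continuous functions are integrable on the sphere `S⁴ ⊂ ℝ⁵` for `μHE⁴` (bounded on a set of
finite measure). [folklore] -/
theorem integrableOn_sphere_of_continuous {G : EuclideanSpace ℝ (Fin 5) → ℝ} (hG : Continuous G) :
    IntegrableOn G (Metric.sphere (0 : EuclideanSpace ℝ (Fin 5)) 1)
      (μHE[4] : Measure (EuclideanSpace ℝ (Fin 5))) := by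
  obtain ⟨M, hM⟩ :=
    (isCompact_sphere (0 : EuclideanSpace ℝ (Fin 5)) 1).exists_bound_of_continuousOn hG.continuousOn
  exact Measure.integrableOn_of_bounded (M := M) euclideanHausdorff_sphere_lt_top.ne
    hG.aestronglyMeasurable
    ((ae_restrict_iff' Metric.isClosed_sphere.measurableSet).2 (ae_of_all _ fun x hx => hM x hx))

/-- The zonal modes `y ↦ a · C_k(∑ yᵢuᵢ)` are continuous. [folklore] -/
theorem continuous_const_mul_gegen_sum (a : ℝ) (k : ℕ) (u : EuclideanSpace ℝ (Fin 5)) :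
    Continuous fun y : EuclideanSpace ℝ (Fin 5) => a * gegen k (∑ i : Fin 5, y i * u i) :=
  continuous_const.mul ((continuous_gegen k).comp (by fun_prop))

/-- The `k = 0` mode integrates to the total mass: `∫_{S⁴} C_0 dμHE⁴ = μHE⁴(S⁴)`. [folklore] -/
theorem integral_gegen_zero (u : EuclideanSpace ℝ (Fin 5)) :
    ∫ y in Metric.sphere (0 : EuclideanSpace ℝ (Fin 5)) 1, gegen 0 (∑ i : Fin 5, y i * u i)
        ∂(μHE[4] : Measure (EuclideanSpace ℝ (Fin 5))) =
      ((μHE[4] : Measure (EuclideanSpace ℝ (Fin 5)))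
        (Metric.sphere (0 : EuclideanSpace ℝ (Fin 5)) 1)).toReal := by
  simp only [gegen_zero, setIntegral_const, smul_eq_mul, mul_one, measureReal_def]

/-- **Integrated recurrence.** For a unit `u` and every `j`,
`∫_{S⁴} C_{j+1}(s) s dμHE⁴ = ((j+2) ∫ C_{j+2}(s) + (j+3) ∫ C_j(s)) / (2j+5)`, `s = ∑ yᵢuᵢ`.
[cite: DLMF, 18.9.1] -/
theorem integral_gegen_succ_mul_self (j : ℕ) (u : EuclideanSpace ℝ (Fin 5)) :
    ∫ y in Metric.sphere (0 : EuclideanSpace ℝ (Fin 5)) 1,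
        gegen (j + 1) (∑ i : Fin 5, y i * u i) * (∑ i : Fin 5, y i * u i)
        ∂(μHE[4] : Measure (EuclideanSpace ℝ (Fin 5))) =
      (((j : ℝ) + 2) * ∫ y in Metric.sphere (0 : EuclideanSpace ℝ (Fin 5)) 1,
          gegen (j + 2) (∑ i : Fin 5, y i * u i) ∂(μHE[4] : Measure (EuclideanSpace ℝ (Fin 5))) +
        ((j : ℝ) + 3) * ∫ y in Metric.sphere (0 : EuclideanSpace ℝ (Fin 5)) 1,
          gegen j (∑ i : Fin 5, y i * u i) ∂(μHE[4] : Measure (EuclideanSpace ℝ (Fin 5)))) /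
        (2 * (j : ℝ) + 5) := by
  simp_rw [gegen_succ_mul_self]
  rw [integral_div, integral_add (integrableOn_sphere_of_continuous (continuous_const_mul_gegen_sum _ _ u))
    (integrableOn_sphere_of_continuous (continuous_const_mul_gegen_sum _ _ u)), integral_const_mul,
    integral_const_mul]

/-- **Only `k = 1` has a first moment.** For a unit `u`: `∫_{S⁴} C_k(s) s dμHE⁴ = 0` for `k ≠ 1`
(`k = 0`: `s = C_1(s)/3`; `k = j+2`: the recurrence and Funk–Hecke for `C_{j+3}`, `C_{j+1}`). [folklore] -/
theorem integral_gegen_mul_self_eq_zero {u : EuclideanSpace ℝ (Fin 5)} (hu : ∑ i : Fin 5, u i ^ 2 = 1)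
    {k : ℕ} (hk : k ≠ 1) :
    ∫ y in Metric.sphere (0 : EuclideanSpace ℝ (Fin 5)) 1,
        gegen k (∑ i : Fin 5, y i * u i) * (∑ i : Fin 5, y i * u i)
        ∂(μHE[4] : Measure (EuclideanSpace ℝ (Fin 5))) = 0 := by
  rcases k with _ | _ | j
  · -- `k = 0`: `C_0(s) s = s = C_1(s) / 3`
    have h1 := stub_funkHeckeVanishing 1 le_rfl u hu
    have hpt : ∀ y : EuclideanSpace ℝ (Fin 5),
        gegen 0 (∑ i : Fin 5, y i * u i) * (∑ i : Fin 5, y i * u i) =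
          (1 / 3 : ℝ) * gegen 1 (∑ i : Fin 5, y i * u i) := fun y => by
      rw [gegen_zero, gegen_one_apply]; ring
    simp_rw [hpt]
    rw [integral_const_mul, h1, mul_zero]
  · exact absurd rfl hk
  · -- `k = j + 2`
    rw [integral_gegen_succ_mul_self (j + 1) u,
      stub_funkHeckeVanishing (j + 1 + 2) (by omega) u hu, stub_funkHeckeVanishing (j + 1) (by omega) u hu]
    simp

/-- **The first moment of `C_1`.** For a unit `u`: `∫_{S⁴} C_1(s) s dμHE⁴ = (3/5) μHE⁴(S⁴)`
(`s C_1 = (2 C_2 + 3 C_0)/5` and Funk–Hecke for `C_2`). [folklore] -/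
theorem integral_gegen_one_mul_self {u : EuclideanSpace ℝ (Fin 5)} (hu : ∑ i : Fin 5, u i ^ 2 = 1) :
    ∫ y in Metric.sphere (0 : EuclideanSpace ℝ (Fin 5)) 1,
        gegen 1 (∑ i : Fin 5, y i * u i) * (∑ i : Fin 5, y i * u i)
        ∂(μHE[4] : Measure (EuclideanSpace ℝ (Fin 5))) =
      3 / 5 * ((μHE[4] : Measure (EuclideanSpace ℝ (Fin 5)))
        (Metric.sphere (0 : EuclideanSpace ℝ (Fin 5)) 1)).toReal := by
  rw [integral_gegen_succ_mul_self 0 u, stub_funkHeckeVanishing (0 + 2) (by omega) u hu,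
    integral_gegen_zero u]
  simp only [Nat.cast_zero, mul_zero, zero_add]
  ring

/-! ## Mass and first moment for `μHE⁴` -/

/-- **Mass (`μHE⁴`).** `∫_{S⁴} 𝔥(t, ∑ xᵢyᵢ) dμHE⁴(y) = μHE⁴(S⁴)` for `t > 0` and a unit `x`
(`stub_zonalSphereIntegral` + `stub_funkHeckeVanishing`). [folklore] -/
theorem mass_euclidean {t : ℝ} (ht : 0 < t) {x : EuclideanSpace ℝ (Fin 5)} (hx : ∑ i : Fin 5, x i ^ 2 = 1) :
    ∫ y in Metric.sphere (0 : EuclideanSpace ℝ (Fin 5)) 1, zonal t (∑ i : Fin 5, y i * x i)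
        ∂(μHE[4] : Measure (EuclideanSpace ℝ (Fin 5))) =
      ((μHE[4] : Measure (EuclideanSpace ℝ (Fin 5)))
        (Metric.sphere (0 : EuclideanSpace ℝ (Fin 5)) 1)).toReal :=
  stub_zonalSphereIntegral stub_funkHeckeVanishing t ht x hx

/-- **First moment (`μHE⁴`).** `∫_{S⁴} 𝔥(t, s) s dμHE⁴ = e^{-4t} μHE⁴(S⁴)` (`s = ∑ yᵢxᵢ`, `t > 0`, `x` a
unit vector): dominated exchange of `∫` and `∑'`, then only the `k = 1` mode survives, with
`wt 1 t · (3/5) = e^{-4t}`. [folklore] -/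
theorem firstMoment_euclidean {t : ℝ} (ht : 0 < t) {x : EuclideanSpace ℝ (Fin 5)}
    (hx : ∑ i : Fin 5, x i ^ 2 = 1) :
    ∫ y in Metric.sphere (0 : EuclideanSpace ℝ (Fin 5)) 1,
        zonal t (∑ i : Fin 5, y i * x i) * (∑ i : Fin 5, y i * x i)
        ∂(μHE[4] : Measure (EuclideanSpace ℝ (Fin 5))) =
      Real.exp (-4 * t) * ((μHE[4] : Measure (EuclideanSpace ℝ (Fin 5)))
        (Metric.sphere (0 : EuclideanSpace ℝ (Fin 5)) 1)).toReal := by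
  set S : Set (EuclideanSpace ℝ (Fin 5)) := Metric.sphere (0 : EuclideanSpace ℝ (Fin 5)) 1 with hS_def
  set μ : Measure (EuclideanSpace ℝ (Fin 5)) := μHE[4] with hμ_def
  have hfin : μ S < ⊤ := euclideanHausdorff_sphere_lt_top
  have hSm : MeasurableSet S := Metric.isClosed_sphere.measurableSet
  -- the terms of the series as functions on `ℝ⁵`
  set F : ℕ → EuclideanSpace ℝ (Fin 5) → ℝ :=
    fun k y => wt k t * gegen k (∑ i : Fin 5, y i * x i) * (∑ i : Fin 5, y i * x i) with hF_def
  have hFc : ∀ k, Continuous (F k) := fun k =>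
    (continuous_const_mul_gegen_sum (wt k t) k x).mul (by fun_prop)
  -- the uniform bound on the sphere (`|s| ≤ 1`)
  set B : ℕ → ℝ := fun k =>
    Real.exp (-(k : ℝ) ^ 2 * t) * (((k + 3).factorial : ℕ) : ℝ) ^ 2 * (2 * (1 : ℝ)) ^ k with hB_def
  have hB : ∀ k, ∀ y ∈ S, ‖F k y‖ ≤ B k := fun k y hy => by
    have hs := abs_sum_mul_le_one_of_mem_sphere hx hy
    rw [hF_def, norm_mul]
    calc ‖wt k t * gegen k (∑ i : Fin 5, y i * x i)‖ * ‖∑ i : Fin 5, y i * x i‖ ≤ B k * 1 :=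
          mul_le_mul (norm_wt_mul_gegen_le ht le_rfl hs k) (by rwa [Real.norm_eq_abs]) (norm_nonneg _)
            (by positivity)
      _ = B k := mul_one _
  -- integrability of each term on the sphere (bounded, finite measure)
  have hFint : ∀ k, Integrable (F k) (μ.restrict S) := fun k =>
    Measure.integrableOn_of_bounded (M := B k) hfin.ne (hFc k).aestronglyMeasurable
      ((ae_restrict_iff' hSm).2 (ae_of_all _ fun y hy => hB k y hy))
  -- summability of the integrated norms
  have hsum : Summable fun k => ∫ y in S, ‖F k y‖ ∂μ := by
    refine Summable.of_nonneg_of_le (fun k => integral_nonneg fun _ => norm_nonneg _) (fun k => ?_)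
      ((summable_majorant ht (c := 2 * (1 : ℝ)) (by norm_num)).mul_right (μ.real S))
    have h := norm_setIntegral_le_of_norm_le_const hfin (f := fun y => ‖F k y‖) (C := B k)
      (fun y hy => by rw [norm_norm]; exact hB k y hy)
    exact (Real.le_norm_self _).trans h
  -- exchange `∫` and `∑'`
  have hz : (fun y : EuclideanSpace ℝ (Fin 5) => zonal t (∑ i : Fin 5, y i * x i) * (∑ i : Fin 5, y i * x i)) =
      fun y => ∑' k, F k y := by
    funext y
    rw [zonal, ← tsum_mul_right]
  rw [hz, ← integral_tsum_of_summable_integral_norm hFint hsum]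
  -- each term: the constant `wt k t` comes out
  have hterm : ∀ k, ∫ y in S, F k y ∂μ =
      wt k t * ∫ y in S, gegen k (∑ i : Fin 5, y i * x i) * (∑ i : Fin 5, y i * x i) ∂μ := fun k => by
    simp only [hF_def, mul_assoc]
    exact integral_const_mul _ _
  simp_rw [hterm]
  rw [tsum_eq_single 1 fun k hk => by rw [hμ_def, hS_def, integral_gegen_mul_self_eq_zero hx hk, mul_zero],
    hμ_def, hS_def, integral_gegen_one_mul_self hx]
  have hwt : wt 1 t = Real.exp (-4 * t) * (5 / 3) := by
    simp only [wt, Nat.cast_one]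
    rw [show -((1 : ℝ) * (1 + 3)) * t = -4 * t by ring]
    norm_num
  rw [hwt]
  ring

end ZonalMassAndFirstMoment

open ZonalMassAndFirstMoment

/-- **Registered helper `helper_zonalMassAndFirstMoment` of line `killing-flux` (plan step S3m: mass and
first moment of the zonal heat kernel of `S⁴` in Mathlib's `μH⁴` normalisation).** For `t > 0` and a unit
`x ∈ ℝ⁵`, with `s(y) = ∑ᵢ xᵢyᵢ` and `𝔥` the typed zonal heat series:
`∫_{S⁴} 𝔥(t, s) dμH⁴ = μH⁴(S⁴)` and `∫_{S⁴} 𝔥(t, s) s dμH⁴ = e^{-4t} μH⁴(S⁴)` (the `μHE⁴` identities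
`mass_euclidean`, `firstMoment_euclidean`, transported by `setIntegral_hausdorff_of_euclideanHausdorff`).
[folklore] -/
theorem helper_zonalMassAndFirstMoment : ∀ t : ℝ, 0 < t → ∀ x : EuclideanSpace ℝ (Fin 5), ∑ i : Fin 5, x i ^ 2 = 1 → (∫ y in Metric.sphere (0 : EuclideanSpace ℝ (Fin 5)) 1, Literature.Geometry.Riemannian.SphericalCylinderEntropy.zonal t (∑ i : Fin 5, x i * y i) ∂(μH[4] : Measure (EuclideanSpace ℝ (Fin 5)))) = (μH[4] (Metric.sphere (0 : EuclideanSpace ℝ (Fin 5)) 1)).toReal ∧ (∫ y in Metric.sphere (0 : EuclideanSpace ℝ (Fin 5)) 1, Literature.Geometry.Riemannian.SphericalCylinderEntropy.zonal t (∑ i : Fin 5, x i * y i) * (∑ i : Fin 5, x i * y i) ∂(μH[4] : Measure (EuclideanSpace ℝ (Fin 5)))) = Real.exp (-4 * t) * (μH[4] (Metric.sphere (0 : EuclideanSpace ℝ (Fin 5)) 1)).toReal := by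
  intro t ht x hx
  have hcomm : ∀ y : EuclideanSpace ℝ (Fin 5), ∑ i : Fin 5, x i * y i = ∑ i : Fin 5, y i * x i :=
    fun y => Finset.sum_congr rfl fun i _ => mul_comm _ _
  simp_rw [hcomm]
  refine ⟨?_, setIntegral_hausdorff_of_euclideanHausdorff (firstMoment_euclidean ht hx)⟩
  have h := setIntegral_hausdorff_of_euclideanHausdorff (r := 1) (f := fun y => zonal t (∑ i : Fin 5, y i * x i))
    (by rw [one_mul]; exact mass_euclidean ht hx)
  rwa [one_mul] at h

end Summit.SmoothPoincare4.SmoothPoincare4.Cruxes.CylinderRungTwo.KillingFlux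

end
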